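import Literature.Probability.RandomPlanarGeometry.ObservableDrivingMartingales
import HarnessLib

/-!
# Driving martingales from the two observable coefficients: general form and the spin case

Topic `Literature/Probability/RandomPlanarGeometry`. Companion of
`ObservableDrivingMartingales.lean` (the FK-Ising case, `κ = 16/3`). The extraction of the two
driving martingales `W_t`, `W_t² - κt` from a martingale observable (Chelkak–Duminil-Copin–
Hongler–Kemppainen–Smirnov, C. R. Math. 352 (2014), §3, last paragraph; Duminil-Copin–Smirnov,
Clay Math. Proc. 15 (2012), proof of Prop. 6.7) only uses the *two coefficient inequalities*
that the far-field expansion of the observable delivers at the stopped clock on the imaginary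
axis — `|Im O_r + a W_{r∧τ_y}/y| ≤ K ((M + √t)/y)³` and
`|Re O_r - 1 + b (W_{r∧τ_y}² - κ (r∧τ_y))/y²| ≤ K ((M + √t)/y)³` — and the martingale property
of `Re O`, `Im O`. This file PROVES the extraction in that generality
(`Loewner.martingale_driver_of_coefficients`: then `W_t` and `W_t² - κt` are martingales), by
the argument of `ObservableDrivingMartingales.lean` with the constants as parameters
(approximate martingales with `L¹` defects `2K E[(M+√t)³]/(|a| y²)`, `2K E[(M+√t)³]/(|b| y)`;
removal of the stopping by dominated convergence; `condExp_ae_eq_of_approx`), and instantiates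
it for the **spin-Ising observable** of CDHKS §3, eq. (5):

> "`M_{t∧τ}(z) = (w_z')^{1/2} w⁻¹ · [1 + W_{t∧τ} w⁻¹ + (W²_{t∧τ} - 3(t∧τ)) w⁻² + O(w⁻³)]` …
> Since (5) is a martingale … both coefficients `W_t` and `W_t² - 3t` are martingales."

namely `Loewner.martingale_driver_of_spinObservable` (PROVED): with
`Loewner.spinObservable W t z = (z² g_t'(z)/(g_t(z) - W_t)²)^{1/2}` (`LoewnerFarField.lean`,
appendix; far-field expansion `1 + W_t/z + (W_t² - 3t)/z² + O(α³)`,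
`FarRegime.norm_spinObservable_sub_le`) and the stopped process
`Loewner.stoppedSpinObservable W y` at `z = iy`, if its real and imaginary parts are martingales
for all large `y` (and `W` is strongly adapted with continuous paths, `W_0 = 0`, running
supremum in `L³`), then `W_t` and `W_t² - 3t` are martingales — the hypothesis format of Lévy's
characterisation with `κ = 3` (`SLELawOfDrivingProcess.lean`), for the spin half of
crit-ising.S17 (`LatticeModels/InterfaceSLEProofs.lean`). The FK instance is `a = 1/2`,
`b = 3/8`, `κ = 16/3`, `K = 64` (kept in its own file); the spin instance is `a = b = 1`,
`κ = 3`, `K = 300`.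

## References

* D. Chelkak, H. Duminil-Copin, C. Hongler, A. Kemppainen, S. Smirnov, *Convergence of Ising
  interfaces to Schramm's SLE curves*, C. R. Math. Acad. Sci. Paris 352 (2014) 157–161, §3,
  eq. (5) and the last paragraph.
* H. Duminil-Copin, S. Smirnov, *Conformal invariance of lattice models*, Clay Math. Proc. 15
  (2012), proof of Prop. 6.7 (p. 29) and §6.4.
-/

noncomputable section

open Set Filter Topology Metric MeasureTheory Complex
open scoped NNReal

namespace Literature.Probability.RandomPlanarGeometry

namespace Loewner

open Literature.Probability.Process

variable {Ω : Type*} {m : MeasurableSpace Ω} {W : ℝ≥0 → Ω → ℝ}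

section General

variable {P : Measure Ω} [IsProbabilityMeasure P] {𝓕 : Filtration ℝ≥0 m}

/-- **Order one, general coefficient**: if a real process `Oim` (the imaginary part of an
observable at level `y`) is a martingale and `|Oim_r + a W_{r∧τ_y}/y| ≤ K ((M + √t)/y)³`
pathwise for `r ≤ t` on the paths with `|W_u| ≤ M` (`u ≤ t`), then the stopped driver is an
approximate martingale: `∫ |E[W_{t∧τ_y} | 𝓕_s] - W_{s∧τ_y}| ≤ 2K E[(M + √t)³]/(|a| y²)`.
[folklore] -/
theorem integral_abs_condExp_stoppedDriver_sub_le_of_coeff (hWad : StronglyAdapted 𝓕 W)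
    (hWc : ∀ ω, Continuous (W · ω)) {y a K : ℝ} (hy : 0 < y) (ha : a ≠ 0)
    {Oim : ℝ≥0 → Ω → ℝ} (him : Martingale Oim 𝓕 P) {s t : ℝ≥0} (hst : s ≤ t)
    {M : Ω → ℝ} (hM : MemLp M 3 P) (hM0 : ∀ ω, 0 ≤ M ω)
    (hbd : ∀ᵐ ω ∂P, ∀ u, u ≤ t → |W u ω| ≤ M ω)
    (hcoef : ∀ᵐ ω ∂P, ∀ r, r ≤ t →
      |Oim r ω + a * stoppedProcess W (farStopTime W y) r ω / y| ≤ K * ((M ω + Real.sqrt t) / y) ^ 3) :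
    ∫ ω, |(P[stoppedProcess W (farStopTime W y) t | 𝓕 s]) ω - stoppedProcess W (farStopTime W y) s ω| ∂P ≤
      2 * K * (∫ ω, (M ω + Real.sqrt t) ^ 3 ∂P) / (|a| * y ^ 2) := by
  set τ := farStopTime W y with hτ
  set A := stoppedProcess W τ t with hA
  set B := stoppedProcess W τ s with hB
  set e : ℝ≥0 → Ω → ℝ := fun r ω ↦ Oim r ω + a * stoppedProcess W τ r ω / y with he
  set C := ∫ ω, (M ω + Real.sqrt t) ^ 3 ∂P with hC
  have hMi : Integrable M P := integrable_of_memLp_three hM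
  have hAi : Integrable A P := integrable_stoppedDriver hWad hWc hMi hbd le_rfl y
  have hBi : Integrable B P := integrable_stoppedDriver hWad hWc hMi hbd hst y
  have hOi : ∀ r, Integrable (Oim r) P := fun r ↦ him.integrable r
  have hei : ∀ r, r ≤ t → Integrable (e r) P := fun r hr ↦
    (hOi r).add (((integrable_stoppedDriver hWad hWc hMi hbd hr y).const_mul a).div_const _)
  have hCi : Integrable (fun ω ↦ (M ω + Real.sqrt t) ^ 3) P :=
    integrable_add_pow_three hM hM0 (Real.sqrt_nonneg _)
  have hebd : ∀ r, r ≤ t → ∀ᵐ ω ∂P, |e r ω| ≤ K / y ^ 3 * (M ω + Real.sqrt t) ^ 3 := by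
    intro r hr
    filter_upwards [hcoef] with ω hω
    have := hω r hr
    rw [div_pow] at this
    calc |e r ω| = |Oim r ω + a * stoppedProcess W (farStopTime W y) r ω / y| := by simp [he, hτ]
      _ ≤ K * ((M ω + Real.sqrt t) ^ 3 / y ^ 3) := this
      _ = K / y ^ 3 * (M ω + Real.sqrt t) ^ 3 := by ring
  have heint : ∀ r, r ≤ t → ∫ ω, |e r ω| ∂P ≤ K / y ^ 3 * C := by
    intro r hr
    calc ∫ ω, |e r ω| ∂P ≤ ∫ ω, K / y ^ 3 * (M ω + Real.sqrt t) ^ 3 ∂P :=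
          integral_mono_ae (hei r hr).abs (hCi.const_mul _) (hebd r hr)
      _ = K / y ^ 3 * C := integral_const_mul _ _
  -- the algebraic identities: `A = (y/a) e - (y/a) Oim`
  have hAe : A = fun ω ↦ (y / a) * e t ω - (y / a) * Oim t ω := by
    funext ω; simp only [he]; field_simp; ring
  have hBe : B = fun ω ↦ (y / a) * e s ω - (y / a) * Oim s ω := by
    funext ω; simp only [he]; field_simp; ring
  have hcond : P[A | 𝓕 s] - B =ᵐ[P] fun ω ↦ (y / a) * ((P[e t | 𝓕 s]) ω - e s ω) := by
    have h1 : P[A | 𝓕 s] =ᵐ[P] P[fun ω ↦ (y / a) * e t ω | 𝓕 s] - P[fun ω ↦ (y / a) * Oim t ω | 𝓕 s] := by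
      rw [hAe]
      exact condExp_sub ((hei t le_rfl).const_mul _) ((hOi t).const_mul _) _
    have h2 : P[fun ω ↦ (y / a) * e t ω | 𝓕 s] =ᵐ[P] fun ω ↦ (y / a) * (P[e t | 𝓕 s]) ω := by
      have : (fun ω ↦ (y / a) * e t ω) = (y / a) • e t := by ext ω; simp
      rw [this]
      filter_upwards [condExp_smul (y / a) (e t) (𝓕 s) (μ := P)] with ω hω
      simp [hω]
    have h3 : P[fun ω ↦ (y / a) * Oim t ω | 𝓕 s] =ᵐ[P] fun ω ↦ (y / a) * Oim s ω := by
      have : (fun ω ↦ (y / a) * Oim t ω) = (y / a) • Oim t := by ext ω; simp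
      rw [this]
      filter_upwards [condExp_smul (y / a) (Oim t) (𝓕 s) (μ := P), him.2 s t hst] with ω hω hω'
      simp [hω, hω']
    filter_upwards [h1, h2, h3] with ω hω1 hω2 hω3
    simp only [Pi.sub_apply] at hω1 ⊢
    rw [hω1, hω2, hω3, hBe]
    ring
  have hya : 0 < y / |a| := div_pos hy (abs_pos.2 ha)
  calc ∫ ω, |(P[A | 𝓕 s]) ω - B ω| ∂P = ∫ ω, (y / |a|) * |(P[e t | 𝓕 s]) ω - e s ω| ∂P := by
        refine integral_congr_ae ?_
        filter_upwards [hcond] with ω hω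
        have : (P[A | 𝓕 s]) ω - B ω = (P[A | 𝓕 s] - B) ω := rfl
        rw [this, hω, abs_mul, abs_div, abs_of_pos hy]
    _ = (y / |a|) * ∫ ω, |(P[e t | 𝓕 s]) ω - e s ω| ∂P := integral_const_mul _ _
    _ ≤ (y / |a|) * (∫ ω, |(P[e t | 𝓕 s]) ω| ∂P + ∫ ω, |e s ω| ∂P) := by
        gcongr
        calc ∫ ω, |(P[e t | 𝓕 s]) ω - e s ω| ∂P ≤ ∫ ω, (|(P[e t | 𝓕 s]) ω| + |e s ω|) ∂P :=
              integral_mono (integrable_condExp.sub (hei s hst)).abs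
                (integrable_condExp.abs.add (hei s hst).abs) fun ω ↦ abs_sub _ _
          _ = ∫ ω, |(P[e t | 𝓕 s]) ω| ∂P + ∫ ω, |e s ω| ∂P :=
              integral_add integrable_condExp.abs (hei s hst).abs
    _ ≤ (y / |a|) * (∫ ω, |e t ω| ∂P + ∫ ω, |e s ω| ∂P) := by
        have h5 : ∫ ω, |(P[e t | 𝓕 s]) ω| ∂P ≤ ∫ ω, |e t ω| ∂P := integral_abs_condExp_le _
        gcongr
    _ ≤ (y / |a|) * (K / y ^ 3 * C + K / y ^ 3 * C) := by
        gcongr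
        · exact heint t le_rfl
        · exact heint s hst
    _ = 2 * K * C / (|a| * y ^ 2) := by
        have : |a| ≠ 0 := abs_ne_zero.2 ha
        field_simp
        ring

omit [IsProbabilityMeasure P] in
/-- The stopped quadratic term `W_{r∧τ}² - κ (r ∧ τ)` is integrable under the moment bound.
[folklore] -/
theorem integrable_stoppedQuad' (hWad : StronglyAdapted 𝓕 W) (hWc : ∀ ω, Continuous (W · ω))
    [IsFiniteMeasure P] {t : ℝ≥0} {M : Ω → ℝ} (hM2 : Integrable (fun ω ↦ M ω ^ 2) P)
    (hbd : ∀ᵐ ω ∂P, ∀ u, u ≤ t → |W u ω| ≤ M ω) {r : ℝ≥0} (hr : r ≤ t) (y κ : ℝ) :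
    Integrable (fun ω ↦ stoppedProcess W (farStopTime W y) r ω ^ 2 -
      κ * (((min (r : WithTop ℝ≥0) (farStopTime W y ω)).untopA : ℝ≥0) : ℝ)) P := by
  refine Integrable.sub ?_ ?_
  · refine hM2.mono' ?_ ?_
    · exact ((continuous_pow 2).comp_stronglyMeasurable
        (stronglyMeasurable_stoppedDriver hWad hWc y r)).aestronglyMeasurable
    · filter_upwards [hbd] with ω hω
      have h1 : |stoppedProcess W (farStopTime W y) r ω| ≤ M ω :=
        hω ((min (r : WithTop ℝ≥0) (farStopTime W y ω)).untopA) ((untopA_min_coe_le r _).trans hr)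
      rw [Real.norm_eq_abs, abs_of_nonneg (by positivity)]
      rw [← sq_abs]; exact pow_le_pow_left₀ (abs_nonneg _) h1 2
  · refine (integrable_const (|κ| * (r : ℝ))).mono' ?_ (ae_of_all _ fun ω ↦ ?_)
    · exact ((stronglyMeasurable_stoppedClock hWad hWc y r).const_mul κ).aestronglyMeasurable
    · rw [Real.norm_eq_abs, abs_mul]
      gcongr
      rw [NNReal.abs_eq]
      exact_mod_cast untopA_min_coe_le r _

/-- **Order two, general coefficient**: if a real process `Ore` (the real part of an observable
at level `y`) is a martingale and `|Ore_r - 1 + b (W_{r∧τ_y}² - κ (r∧τ_y))/y²| ≤ K ((M + √t)/y)³`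
pathwise, then `Q_r = W_{r∧τ_y}² - κ (r ∧ τ_y)` is an approximate martingale:
`∫ |E[Q_t | 𝓕_s] - Q_s| ≤ 2K E[(M + √t)³]/(|b| y)`. [folklore] -/
theorem integral_abs_condExp_stoppedQuad_sub_le_of_coeff (hWad : StronglyAdapted 𝓕 W)
    (hWc : ∀ ω, Continuous (W · ω)) {y b κ K : ℝ} (hy : 0 < y) (hb : b ≠ 0)
    {Ore : ℝ≥0 → Ω → ℝ} (hre : Martingale Ore 𝓕 P) {s t : ℝ≥0} (hst : s ≤ t)
    {M : Ω → ℝ} (hM : MemLp M 3 P) (hM0 : ∀ ω, 0 ≤ M ω)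
    (hbd : ∀ᵐ ω ∂P, ∀ u, u ≤ t → |W u ω| ≤ M ω)
    (hcoef : ∀ᵐ ω ∂P, ∀ r, r ≤ t →
      |Ore r ω - 1 + b * (stoppedProcess W (farStopTime W y) r ω ^ 2 -
        κ * (((min (r : WithTop ℝ≥0) (farStopTime W y ω)).untopA : ℝ≥0) : ℝ)) / y ^ 2| ≤
        K * ((M ω + Real.sqrt t) / y) ^ 3) :
    ∫ ω, |(P[fun ω ↦ stoppedProcess W (farStopTime W y) t ω ^ 2 -
          κ * (((min (t : WithTop ℝ≥0) (farStopTime W y ω)).untopA : ℝ≥0) : ℝ) | 𝓕 s]) ω -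
        (stoppedProcess W (farStopTime W y) s ω ^ 2 -
          κ * (((min (s : WithTop ℝ≥0) (farStopTime W y ω)).untopA : ℝ≥0) : ℝ))| ∂P ≤
      2 * K * (∫ ω, (M ω + Real.sqrt t) ^ 3 ∂P) / (|b| * y) := by
  set τ := farStopTime W y with hτ
  set Q : ℝ≥0 → Ω → ℝ := fun r ω ↦ stoppedProcess W τ r ω ^ 2 -
    κ * (((min (r : WithTop ℝ≥0) (τ ω)).untopA : ℝ≥0) : ℝ) with hQ
  set f : ℝ≥0 → Ω → ℝ := fun r ω ↦ Ore r ω - 1 + b * Q r ω / y ^ 2 with hf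
  set C := ∫ ω, (M ω + Real.sqrt t) ^ 3 ∂P with hC
  have hMi : Integrable M P := integrable_of_memLp_three hM
  have hM2 : Integrable (fun ω ↦ M ω ^ 2) P := integrable_sq_of_memLp_three hM
  have hQi : ∀ r, r ≤ t → Integrable (Q r) P := fun r hr ↦ integrable_stoppedQuad' hWad hWc hM2 hbd hr y κ
  have hOi : ∀ r, Integrable (Ore r) P := fun r ↦ hre.integrable r
  have hfi : ∀ r, r ≤ t → Integrable (f r) P := fun r hr ↦
    ((hOi r).sub (integrable_const _)).add (((hQi r hr).const_mul b).div_const _)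
  have hCi : Integrable (fun ω ↦ (M ω + Real.sqrt t) ^ 3) P :=
    integrable_add_pow_three hM hM0 (Real.sqrt_nonneg _)
  have hfbd : ∀ r, r ≤ t → ∀ᵐ ω ∂P, |f r ω| ≤ K / y ^ 3 * (M ω + Real.sqrt t) ^ 3 := by
    intro r hr
    filter_upwards [hcoef] with ω hω
    have := hω r hr
    rw [div_pow] at this
    simp only [hf, hQ, hτ]
    calc _ ≤ K * ((M ω + Real.sqrt t) ^ 3 / y ^ 3) := this
      _ = K / y ^ 3 * (M ω + Real.sqrt t) ^ 3 := by ring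
  have hfint : ∀ r, r ≤ t → ∫ ω, |f r ω| ∂P ≤ K / y ^ 3 * C := by
    intro r hr
    calc ∫ ω, |f r ω| ∂P ≤ ∫ ω, K / y ^ 3 * (M ω + Real.sqrt t) ^ 3 ∂P :=
          integral_mono_ae (hfi r hr).abs (hCi.const_mul _) (hfbd r hr)
      _ = K / y ^ 3 * C := integral_const_mul _ _
  have hyb : y ^ 2 / b ≠ 0 := div_ne_zero (by positivity) hb
  -- `Q = (y²/b)(f - Ore + 1)`
  have hQe : ∀ r, Q r = (fun ω ↦ (y ^ 2 / b) * f r ω - (y ^ 2 / b) * Ore r ω) + fun _ ↦ y ^ 2 / b := by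
    intro r; funext ω; simp only [hf, Pi.add_apply]; field_simp; ring
  have hcond : P[Q t | 𝓕 s] - Q s =ᵐ[P] fun ω ↦ (y ^ 2 / b) * ((P[f t | 𝓕 s]) ω - f s ω) := by
    have hint1 : Integrable (fun ω ↦ (y ^ 2 / b) * f t ω - (y ^ 2 / b) * Ore t ω) P :=
      ((hfi t le_rfl).const_mul _).sub ((hOi t).const_mul _)
    have h1 : P[Q t | 𝓕 s] =ᵐ[P]
        P[fun ω ↦ (y ^ 2 / b) * f t ω - (y ^ 2 / b) * Ore t ω | 𝓕 s] + P[fun _ ↦ (y ^ 2 / b : ℝ) | 𝓕 s] := by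
      rw [hQe t]
      exact condExp_add hint1 (integrable_const _) _
    have h1' : P[fun ω ↦ (y ^ 2 / b) * f t ω - (y ^ 2 / b) * Ore t ω | 𝓕 s] =ᵐ[P]
        P[fun ω ↦ (y ^ 2 / b) * f t ω | 𝓕 s] - P[fun ω ↦ (y ^ 2 / b) * Ore t ω | 𝓕 s] :=
      condExp_sub ((hfi t le_rfl).const_mul _) ((hOi t).const_mul _) _
    have h2 : P[fun ω ↦ (y ^ 2 / b) * f t ω | 𝓕 s] =ᵐ[P] fun ω ↦ (y ^ 2 / b) * (P[f t | 𝓕 s]) ω := by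
      have : (fun ω ↦ (y ^ 2 / b) * f t ω) = (y ^ 2 / b) • f t := by ext ω; simp
      rw [this]
      filter_upwards [condExp_smul (y ^ 2 / b) (f t) (𝓕 s) (μ := P)] with ω hω
      simp [hω]
    have h3 : P[fun ω ↦ (y ^ 2 / b) * Ore t ω | 𝓕 s] =ᵐ[P] fun ω ↦ (y ^ 2 / b) * Ore s ω := by
      have : (fun ω ↦ (y ^ 2 / b) * Ore t ω) = (y ^ 2 / b) • Ore t := by ext ω; simp
      rw [this]
      filter_upwards [condExp_smul (y ^ 2 / b) (Ore t) (𝓕 s) (μ := P), hre.2 s t hst] with ω hω hω'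
      simp [hω, hω']
    have h4 : P[fun _ ↦ (y ^ 2 / b : ℝ) | 𝓕 s] = fun _ ↦ (y ^ 2 / b : ℝ) := condExp_const (𝓕.le s) _
    filter_upwards [h1, h1', h2, h3] with ω hω1 hω1' hω2 hω3
    simp only [Pi.sub_apply, Pi.add_apply] at hω1 hω1' ⊢
    rw [hω1, hω1', hω2, hω3, h4, hQe s]
    simp only [Pi.add_apply]
    ring
  have hyb' : 0 < y ^ 2 / |b| := div_pos (by positivity) (abs_pos.2 hb)
  calc ∫ ω, |(P[Q t | 𝓕 s]) ω - Q s ω| ∂P = ∫ ω, (y ^ 2 / |b|) * |(P[f t | 𝓕 s]) ω - f s ω| ∂P := by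
        refine integral_congr_ae ?_
        filter_upwards [hcond] with ω hω
        have : (P[Q t | 𝓕 s]) ω - Q s ω = (P[Q t | 𝓕 s] - Q s) ω := rfl
        rw [this, hω, abs_mul, abs_div, abs_of_pos (by positivity : (0 : ℝ) < y ^ 2)]
    _ = (y ^ 2 / |b|) * ∫ ω, |(P[f t | 𝓕 s]) ω - f s ω| ∂P := integral_const_mul _ _
    _ ≤ (y ^ 2 / |b|) * (∫ ω, |(P[f t | 𝓕 s]) ω| ∂P + ∫ ω, |f s ω| ∂P) := by
        gcongr
        calc ∫ ω, |(P[f t | 𝓕 s]) ω - f s ω| ∂P ≤ ∫ ω, (|(P[f t | 𝓕 s]) ω| + |f s ω|) ∂P :=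
              integral_mono (integrable_condExp.sub (hfi s hst)).abs
                (integrable_condExp.abs.add (hfi s hst).abs) fun ω ↦ abs_sub _ _
          _ = ∫ ω, |(P[f t | 𝓕 s]) ω| ∂P + ∫ ω, |f s ω| ∂P :=
              integral_add integrable_condExp.abs (hfi s hst).abs
    _ ≤ (y ^ 2 / |b|) * (∫ ω, |f t ω| ∂P + ∫ ω, |f s ω| ∂P) := by
        have h5 : ∫ ω, |(P[f t | 𝓕 s]) ω| ∂P ≤ ∫ ω, |f t ω| ∂P := integral_abs_condExp_le _
        gcongr
    _ ≤ (y ^ 2 / |b|) * (K / y ^ 3 * C + K / y ^ 3 * C) := by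
        gcongr
        · exact hfint t le_rfl
        · exact hfint s hst
    _ = 2 * K * C / (|b| * y) := by
        have : |b| ≠ 0 := abs_ne_zero.2 hb
        field_simp
        ring

omit [IsProbabilityMeasure P] in
/-- **Removing the stopping, order two (general `κ`)**:
`∫ |(W_r² - κ r) - (W_{r∧τ}² - κ (r ∧ τ))| → 0` along `y = y₁ + n`. [folklore] -/
theorem tendsto_integral_abs_sub_stoppedQuad' (hWad : StronglyAdapted 𝓕 W)
    (hWc : ∀ ω, Continuous (W · ω)) [IsFiniteMeasure P] {t : ℝ≥0} {M : Ω → ℝ}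
    (hM2 : Integrable (fun ω ↦ M ω ^ 2) P)
    (hbd : ∀ᵐ ω ∂P, ∀ u, u ≤ t → |W u ω| ≤ M ω) {r : ℝ≥0} (hr : r ≤ t) (y₁ κ : ℝ) :
    Tendsto (fun n : ℕ ↦ ∫ ω, |(W r ω ^ 2 - κ * (r : ℝ)) -
      (stoppedProcess W (farStopTime W (y₁ + n)) r ω ^ 2 -
        κ * (((min (r : WithTop ℝ≥0) (farStopTime W (y₁ + n) ω)).untopA : ℝ≥0) : ℝ))| ∂P)
      atTop (𝓝 0) := by
  have hXm : AEStronglyMeasurable (fun ω ↦ W r ω ^ 2 - κ * (r : ℝ)) P :=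
    (((continuous_pow 2).comp_stronglyMeasurable ((hWad r).mono (𝓕.le r))).sub
      stronglyMeasurable_const).aestronglyMeasurable
  have hmeas : ∀ n : ℕ, AEStronglyMeasurable (fun ω ↦ |(W r ω ^ 2 - κ * (r : ℝ)) -
      (stoppedProcess W (farStopTime W (y₁ + n)) r ω ^ 2 -
        κ * (((min (r : WithTop ℝ≥0) (farStopTime W (y₁ + n) ω)).untopA : ℝ≥0) : ℝ))|) P :=
    fun n ↦ (hXm.sub (integrable_stoppedQuad' hWad hWc hM2 hbd hr _ κ).aestronglyMeasurable).norm
  have hlim := tendsto_integral_of_dominated_convergence (μ := P)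
    (fun ω ↦ 2 * M ω ^ 2 + 2 * |κ| * r) hmeas
    ((hM2.const_mul 2).add (integrable_const _))
    (fun n ↦ by
      filter_upwards [hbd] with ω hω
      rw [Real.norm_eq_abs, abs_abs]
      set A := stoppedProcess W (farStopTime W (y₁ + n)) r ω with hA
      set σ := (min (r : WithTop ℝ≥0) (farStopTime W (y₁ + n) ω)).untopA with hσ
      have hσr : (σ : ℝ) ≤ r := by exact_mod_cast untopA_min_coe_le r _
      have hσ0 : (0 : ℝ) ≤ σ := σ.coe_nonneg
      have h1' : W r ω ^ 2 ≤ M ω ^ 2 := by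
        rw [← sq_abs]; exact pow_le_pow_left₀ (abs_nonneg _) (hω r hr) 2
      have h2' : A ^ 2 ≤ M ω ^ 2 := by
        rw [← sq_abs]; exact pow_le_pow_left₀ (abs_nonneg _) (hω σ ((untopA_min_coe_le r _).trans hr)) 2
      have hr0 : (0 : ℝ) ≤ r := r.coe_nonneg
      have hk1 : |κ * (r : ℝ)| ≤ |κ| * r := by rw [abs_mul, abs_of_nonneg hr0]
      have hk2 : |κ * (σ : ℝ)| ≤ |κ| * r := by
        rw [abs_mul, abs_of_nonneg hσ0]; exact mul_le_mul_of_nonneg_left hσr (abs_nonneg _)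
      calc |W r ω ^ 2 - κ * r - (A ^ 2 - κ * σ)|
          ≤ |W r ω ^ 2 - κ * r| + |A ^ 2 - κ * σ| := abs_sub _ _
        _ ≤ (|W r ω ^ 2| + |κ * (r : ℝ)|) + (|A ^ 2| + |κ * (σ : ℝ)|) :=
            add_le_add (abs_sub _ _) (abs_sub _ _)
        _ ≤ (M ω ^ 2 + |κ| * r) + (M ω ^ 2 + |κ| * r) := by
            rw [abs_of_nonneg (sq_nonneg (W r ω)), abs_of_nonneg (sq_nonneg A)]
            gcongr
        _ = 2 * M ω ^ 2 + 2 * |κ| * r := by ring)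
    (f := fun _ ↦ 0)
    (ae_of_all _ fun ω ↦ by
      obtain ⟨Y, hY⟩ := exists_forall_lt_farStopTime hWc ω r
      obtain ⟨N, hN⟩ := exists_nat_ge (Y - y₁)
      refine tendsto_atTop_of_eventually_const (i₀ := N) fun n hn ↦ ?_
      have hy : Y ≤ y₁ + n := by
        have : (N : ℝ) ≤ n := by exact_mod_cast hn
        linarith
      have hlt := hY _ hy
      rw [stoppedProcess_eq_of_le hlt.le, min_eq_left hlt.le, untopA_coe, sub_self, abs_zero])
  simpa using hlim

/-- **The two driving martingales from the two observable coefficients** (general form of the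
coefficient matching of CDHKS 2014, §3 / DCS 2012, proof of Prop. 6.7): let `W` be strongly
adapted with continuous paths, `W_0 = 0`, with the running supremum on each `[0, t]` dominated by
a nonnegative `M ∈ L³`. Suppose that for every level `y ≥ y₀` there are real processes `Ore y`,
`Oim y`, both `𝓕`-martingales, such that pathwise, for `r ≤ t` on the paths with
`|W_u| ≤ M` (`u ≤ t`),
`|Oim y r + a W_{r∧τ_y}/y| ≤ K ((M + √t)/y)³` and
`|Ore y r - 1 + b (W_{r∧τ_y}² - κ (r∧τ_y))/y²| ≤ K ((M + √t)/y)³` with `a, b ≠ 0`.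
Then `W_t` and `W_t² - κ t` are `𝓕`-martingales. (FK-Ising: `a = 1/2`, `b = 3/8`, `κ = 16/3`;
spin-Ising: `a = b = 1`, `κ = 3`.) [cite: CDHKSCRAS2014, §3] -/
theorem martingale_driver_of_coefficients (hWad : StronglyAdapted 𝓕 W) (hWc : ∀ ω, Continuous (W · ω))
    (hmom : ∀ t : ℝ≥0, ∃ M : Ω → ℝ, MemLp M 3 P ∧ (∀ ω, 0 ≤ M ω) ∧ ∀ᵐ ω ∂P, ∀ u, u ≤ t → |W u ω| ≤ M ω)
    {a b κ K y₀ : ℝ} (ha : a ≠ 0) (hb : b ≠ 0) (hy₀ : 0 < y₀)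
    {Ore Oim : ℝ → ℝ≥0 → Ω → ℝ}
    (hre : ∀ y, y₀ ≤ y → Martingale (Ore y) 𝓕 P) (him : ∀ y, y₀ ≤ y → Martingale (Oim y) 𝓕 P)
    (hcoef_im : ∀ y, y₀ ≤ y → ∀ (t : ℝ≥0) (M : Ω → ℝ), (∀ ω, 0 ≤ M ω) →
      ∀ᵐ ω ∂P, (∀ u, u ≤ t → |W u ω| ≤ M ω) → ∀ r, r ≤ t →
        |Oim y r ω + a * stoppedProcess W (farStopTime W y) r ω / y| ≤ K * ((M ω + Real.sqrt t) / y) ^ 3)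
    (hcoef_re : ∀ y, y₀ ≤ y → ∀ (t : ℝ≥0) (M : Ω → ℝ), (∀ ω, 0 ≤ M ω) →
      ∀ᵐ ω ∂P, (∀ u, u ≤ t → |W u ω| ≤ M ω) → ∀ r, r ≤ t →
        |Ore y r ω - 1 + b * (stoppedProcess W (farStopTime W y) r ω ^ 2 -
          κ * (((min (r : WithTop ℝ≥0) (farStopTime W y ω)).untopA : ℝ≥0) : ℝ)) / y ^ 2| ≤
          K * ((M ω + Real.sqrt t) / y) ^ 3) :
    Martingale W 𝓕 P ∧ Martingale (fun t ω ↦ W t ω ^ 2 - κ * (t : ℝ)) 𝓕 P := by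
  have hyseq : ∀ n : ℕ, y₀ ≤ y₀ + n ∧ 0 < y₀ + n := fun n ↦
    ⟨by have : (0:ℝ) ≤ n := n.cast_nonneg; linarith, by have : (0:ℝ) ≤ n := n.cast_nonneg; linarith⟩
  refine ⟨⟨hWad, fun s t hst ↦ ?_⟩, ⟨fun t ↦ ?_, fun s t hst ↦ ?_⟩⟩
  · -- order one
    obtain ⟨M, hM, hM0, hbd⟩ := hmom t
    have hMi : Integrable M P := integrable_of_memLp_three hM
    set C := ∫ ω, (M ω + Real.sqrt t) ^ 3 ∂P with hC
    have ha' := tendsto_integral_abs_sub_stoppedDriver hWad hWc hMi hbd le_rfl y₀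
    have hb' := tendsto_integral_abs_sub_stoppedDriver hWad hWc hMi hbd hst y₀
    have hc' : Tendsto (fun n : ℕ ↦ 2 * K * C / (|a| * (y₀ + n) ^ 2)) atTop (𝓝 0) := by
      have h1 : Tendsto (fun n : ℕ ↦ (y₀ + n : ℝ)) atTop atTop :=
        tendsto_atTop_add_const_left atTop y₀ tendsto_natCast_atTop_atTop
      have h2 : Tendsto (fun n : ℕ ↦ |a| * (y₀ + n : ℝ) ^ 2) atTop atTop :=
        ((tendsto_pow_atTop two_ne_zero).comp h1).const_mul_atTop (abs_pos.2 ha)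
      exact tendsto_const_nhds.div_atTop h2
    refine condExp_ae_eq_of_approx (integrable_driver hWad hMi hbd le_rfl)
      (integrable_driver hWad hMi hbd hst) fun ε hε ↦ ?_
    obtain ⟨n, hna, hnb, hnc⟩ := ((ha'.eventually (gt_mem_nhds hε)).and
      ((hb'.eventually (gt_mem_nhds hε)).and (hc'.eventually (gt_mem_nhds hε)))).exists
    set y : ℝ := y₀ + n with hy
    refine ⟨stoppedProcess W (farStopTime W y) t, stoppedProcess W (farStopTime W y) s,
      integrable_stoppedDriver hWad hWc hMi hbd le_rfl y, integrable_stoppedDriver hWad hWc hMi hbd hst y,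
      hna.le, ?_, ?_⟩
    · refine le_trans (le_of_eq (integral_congr_ae (ae_of_all _ fun ω ↦ ?_))) hnb.le
      exact abs_sub_comm _ _
    · have hco : ∀ᵐ ω ∂P, ∀ r, r ≤ t →
          |Oim y r ω + a * stoppedProcess W (farStopTime W y) r ω / y| ≤
            K * ((M ω + Real.sqrt t) / y) ^ 3 := by
        filter_upwards [hcoef_im y (hyseq n).1 t M hM0, hbd] with ω hω hω'
        exact hω hω'
      exact (integral_abs_condExp_stoppedDriver_sub_le_of_coeff hWad hWc (hyseq n).2 ha
        (him y (hyseq n).1) hst hM hM0 hbd hco).trans hnc.le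
  · exact ((continuous_pow 2).comp_stronglyMeasurable (hWad t)).sub stronglyMeasurable_const
  · -- order two
    obtain ⟨M, hM, hM0, hbd⟩ := hmom t
    have hMi : Integrable M P := integrable_of_memLp_three hM
    have hM2 : Integrable (fun ω ↦ M ω ^ 2) P := integrable_sq_of_memLp_three hM
    have hXi : ∀ r, r ≤ t → Integrable (fun ω ↦ W r ω ^ 2 - κ * (r : ℝ)) P := by
      intro r hr
      refine Integrable.sub ?_ (integrable_const _)
      refine hM2.mono' ?_ ?_
      · exact ((continuous_pow 2).comp_stronglyMeasurable ((hWad r).mono (𝓕.le r))).aestronglyMeasurable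
      · filter_upwards [hbd] with ω hω
        rw [Real.norm_eq_abs, abs_of_nonneg (by positivity)]
        rw [← sq_abs]; exact pow_le_pow_left₀ (abs_nonneg _) (hω r hr) 2
    set C := ∫ ω, (M ω + Real.sqrt t) ^ 3 ∂P with hC
    have ha' := tendsto_integral_abs_sub_stoppedQuad' hWad hWc hM2 hbd le_rfl y₀ κ
    have hb' := tendsto_integral_abs_sub_stoppedQuad' hWad hWc hM2 hbd hst y₀ κ
    have hc' : Tendsto (fun n : ℕ ↦ 2 * K * C / (|b| * (y₀ + n))) atTop (𝓝 0) := by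
      have h1 : Tendsto (fun n : ℕ ↦ (y₀ + n : ℝ)) atTop atTop :=
        tendsto_atTop_add_const_left atTop y₀ tendsto_natCast_atTop_atTop
      exact tendsto_const_nhds.div_atTop (h1.const_mul_atTop (abs_pos.2 hb))
    refine condExp_ae_eq_of_approx (hXi t le_rfl) (hXi s hst) fun ε hε ↦ ?_
    obtain ⟨n, hna, hnb, hnc⟩ := ((ha'.eventually (gt_mem_nhds hε)).and
      ((hb'.eventually (gt_mem_nhds hε)).and (hc'.eventually (gt_mem_nhds hε)))).exists
    set y : ℝ := y₀ + n with hy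
    refine ⟨fun ω ↦ stoppedProcess W (farStopTime W y) t ω ^ 2 -
        κ * (((min (t : WithTop ℝ≥0) (farStopTime W y ω)).untopA : ℝ≥0) : ℝ),
      fun ω ↦ stoppedProcess W (farStopTime W y) s ω ^ 2 -
        κ * (((min (s : WithTop ℝ≥0) (farStopTime W y ω)).untopA : ℝ≥0) : ℝ),
      integrable_stoppedQuad' hWad hWc hM2 hbd le_rfl y κ, integrable_stoppedQuad' hWad hWc hM2 hbd hst y κ,
      hna.le, ?_, ?_⟩
    · refine le_trans (le_of_eq (integral_congr_ae (ae_of_all _ fun ω ↦ ?_))) hnb.le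
      exact abs_sub_comm _ _
    · have hco : ∀ᵐ ω ∂P, ∀ r, r ≤ t →
          |Ore y r ω - 1 + b * (stoppedProcess W (farStopTime W y) r ω ^ 2 -
            κ * (((min (r : WithTop ℝ≥0) (farStopTime W y ω)).untopA : ℝ≥0) : ℝ)) / y ^ 2| ≤
            K * ((M ω + Real.sqrt t) / y) ^ 3 := by
        filter_upwards [hcoef_re y (hyseq n).1 t M hM0, hbd] with ω hω hω'
        exact hω hω'
      exact (integral_abs_condExp_stoppedQuad_sub_le_of_coeff hWad hWc (hyseq n).2 hb
        (hre y (hyseq n).1) hst hM hM0 hbd hco).trans hnc.le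

end General

/-! ### The spin-Ising instance -/

section Spin

/-- **The stopped spin-Ising martingale observable process** at `z = iy`: CDHKS's
`M_{t∧τ}(z)` (times `z`), i.e. `Loewner.spinObservable` of the Loewner chain of the path,
evaluated at the stopped clock `r ∧ τ_y`. [cite: CDHKSCRAS2014, §3 eq. (5)] -/
def stoppedSpinObservable (W : ℝ≥0 → Ω → ℝ) (y : ℝ) : ℝ≥0 → Ω → ℂ :=
  stoppedProcess (fun r ω ↦ spinObservable (fun u ↦ W u ω) r (I * y)) (farStopTime W y)

/-- **Pathwise expansion of the stopped spin observable** at the stopped clock: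
`‖O_r - (1 + A_r/(iy) + (A_r² - 3σ_r)/(iy)²)‖ ≤ 300 ((M + √t)/y)³`. [cite: CDHKSCRAS2014, §3 eq. (5)] -/
theorem norm_stoppedSpinObservable_sub_le (hWc : ∀ ω, Continuous (W · ω)) (hW0 : ∀ ω, W 0 ω = 0)
    {y : ℝ} (hy : 0 < y) {ω : Ω} {t : ℝ≥0} {M : ℝ} (hM0 : 0 ≤ M) (hM : ∀ u, u ≤ t → |W u ω| ≤ M)
    {r : ℝ≥0} (hr : r ≤ t) :
    ‖stoppedSpinObservable W y r ω -
        (1 + ((stoppedProcess W (farStopTime W y) r ω : ℝ) : ℂ) / (I * y) +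
          (((stoppedProcess W (farStopTime W y) r ω : ℝ) : ℂ) ^ 2 -
              3 * (((min (r : WithTop ℝ≥0) (farStopTime W y ω)).untopA : ℝ) : ℂ)) / (I * y) ^ 2)‖ ≤
      300 * ((M + Real.sqrt t) / y) ^ 3 := by
  have hreg := farRegime_stopped hWc hW0 hy hM hr
  set σ := (min (r : WithTop ℝ≥0) (farStopTime W y ω)).untopA with hσ
  have hσt : σ ≤ t := (untopA_min_coe_le r _).trans hr
  have hmain := hreg.norm_spinObservable_sub_le
  have hnorm : ‖I * (y : ℂ)‖ = y := by simp [abs_of_pos hy]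
  rw [hnorm] at hmain
  refine (le_of_eq ?_).trans (hmain.trans ?_)
  · rfl
  · have hK : min M (y / 128) + Real.sqrt σ ≤ M + Real.sqrt t := by
      gcongr
      · exact min_le_left _ _
    have hK0 : 0 ≤ min M (y / 128) + Real.sqrt σ :=
      add_nonneg (le_min hM0 (by positivity)) (Real.sqrt_nonneg _)
    gcongr

/-- Real and imaginary parts of the spin main term at `z = iy`:
`1 + w/(iy) + (w² - 3σ)/(iy)² = (1 - (w² - 3σ)/y²) + (-w/y) i`. [folklore] -/
theorem spin_main_term_eq {y : ℝ} (hy : y ≠ 0) (w s : ℝ) :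
    (1 : ℂ) + (w : ℂ) / (I * y) + ((w : ℂ) ^ 2 - 3 * (s : ℂ)) / (I * y) ^ 2 =
      ((1 - (w ^ 2 - 3 * s) / y ^ 2 : ℝ) : ℂ) + ((-w / y : ℝ) : ℂ) * I := by
  have hy' : (y : ℂ) ≠ 0 := by exact_mod_cast hy
  push_cast
  field_simp
  ring_nf
  simp only [I_sq, I_pow_three]
  ring

/-- **Imaginary part (spin): `|Im O_r + A_r/y| ≤ 300 ((M + √t)/y)³`.** [folklore] -/
theorem abs_im_stoppedSpinObservable_add_le (hWc : ∀ ω, Continuous (W · ω)) (hW0 : ∀ ω, W 0 ω = 0)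
    {y : ℝ} (hy : 0 < y) {ω : Ω} {t : ℝ≥0} {M : ℝ} (hM0 : 0 ≤ M) (hM : ∀ u, u ≤ t → |W u ω| ≤ M)
    {r : ℝ≥0} (hr : r ≤ t) :
    |(stoppedSpinObservable W y r ω).im + 1 * stoppedProcess W (farStopTime W y) r ω / y| ≤
      300 * ((M + Real.sqrt t) / y) ^ 3 := by
  have h := norm_stoppedSpinObservable_sub_le hWc hW0 hy hM0 hM hr
  rw [spin_main_term_eq hy.ne'] at h
  set a : ℝ := 1 - (stoppedProcess W (farStopTime W y) r ω ^ 2 -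
      3 * ((min (r : WithTop ℝ≥0) (farStopTime W y ω)).untopA : ℝ)) / y ^ 2 with ha
  set b : ℝ := -stoppedProcess W (farStopTime W y) r ω / y with hb
  set O := stoppedSpinObservable W y r ω with hO
  have him : (O - ((a : ℂ) + (b : ℂ) * I)).im = O.im + 1 * stoppedProcess W (farStopTime W y) r ω / y := by
    simp only [sub_im, add_im, ofReal_im, mul_im, ofReal_re, I_re, I_im, mul_zero, mul_one, zero_add,
      add_zero, hb]
    ring
  rw [← him]
  exact (abs_im_le_norm _).trans h

/-- **Real part (spin): `|Re O_r - 1 + (A_r² - 3σ_r)/y²| ≤ 300 ((M + √t)/y)³`.** [folklore] -/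
theorem abs_re_stoppedSpinObservable_sub_le (hWc : ∀ ω, Continuous (W · ω)) (hW0 : ∀ ω, W 0 ω = 0)
    {y : ℝ} (hy : 0 < y) {ω : Ω} {t : ℝ≥0} {M : ℝ} (hM0 : 0 ≤ M) (hM : ∀ u, u ≤ t → |W u ω| ≤ M)
    {r : ℝ≥0} (hr : r ≤ t) :
    |(stoppedSpinObservable W y r ω).re - 1 +
        1 * (stoppedProcess W (farStopTime W y) r ω ^ 2 -
          3 * ((min (r : WithTop ℝ≥0) (farStopTime W y ω)).untopA : ℝ)) / y ^ 2| ≤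
      300 * ((M + Real.sqrt t) / y) ^ 3 := by
  have h := norm_stoppedSpinObservable_sub_le hWc hW0 hy hM0 hM hr
  rw [spin_main_term_eq hy.ne'] at h
  set a : ℝ := 1 - (stoppedProcess W (farStopTime W y) r ω ^ 2 -
      3 * ((min (r : WithTop ℝ≥0) (farStopTime W y ω)).untopA : ℝ)) / y ^ 2 with ha
  set b : ℝ := -stoppedProcess W (farStopTime W y) r ω / y with hb
  set O := stoppedSpinObservable W y r ω with hO
  have hre : (O - ((a : ℂ) + (b : ℂ) * I)).re = O.re - 1 +
      1 * (stoppedProcess W (farStopTime W y) r ω ^ 2 -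
        3 * ((min (r : WithTop ℝ≥0) (farStopTime W y ω)).untopA : ℝ)) / y ^ 2 := by
    simp only [sub_re, add_re, ofReal_re, mul_re, ofReal_im, I_re, I_im, mul_zero, mul_one, sub_zero,
      ha]
    ring
  rw [← hre]
  exact (abs_re_le_norm _).trans h

variable {P : Measure Ω} [IsProbabilityMeasure P] {𝓕 : Filtration ℝ≥0 m}

/-- **The spin-Ising martingale observable forces the driving martingales `W_t`, `W_t² - 3t`**
(CDHKS 2014, §3, last paragraph: "we can exchange the asymptotic expansion with the conditional
expectation and conclude that both coefficients `W_t` and `W_t² - 3t` are martingales"): for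
`W` strongly adapted with continuous paths, `W_0 = 0` and running supremum dominated on each
`[0, t]` by a nonnegative `M ∈ L³`, if for all levels `y ≥ y₀` the real and imaginary parts of
the stopped spin observable `stoppedSpinObservable W y` are `𝓕`-martingales, then `W_t` and
`W_t² - 3t` are `𝓕`-martingales (the hypothesis format of Lévy's characterisation with `κ = 3`).
PROVED, by `martingale_driver_of_coefficients` with `a = b = 1`, `κ = 3`, `K = 300`.
[cite: CDHKSCRAS2014, §3] -/
theorem martingale_driver_of_spinObservable (hWad : StronglyAdapted 𝓕 W)
    (hWc : ∀ ω, Continuous (W · ω)) (hW0 : ∀ ω, W 0 ω = 0)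
    (hmom : ∀ t : ℝ≥0, ∃ M : Ω → ℝ, MemLp M 3 P ∧ (∀ ω, 0 ≤ M ω) ∧ ∀ᵐ ω ∂P, ∀ u, u ≤ t → |W u ω| ≤ M ω)
    {y₀ : ℝ} (hre : ∀ y, y₀ ≤ y → Martingale (fun r ω ↦ (stoppedSpinObservable W y r ω).re) 𝓕 P)
    (him : ∀ y, y₀ ≤ y → Martingale (fun r ω ↦ (stoppedSpinObservable W y r ω).im) 𝓕 P) :
    Martingale W 𝓕 P ∧ Martingale (fun t ω ↦ W t ω ^ 2 - 3 * (t : ℝ)) 𝓕 P := by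
  set y₁ : ℝ := max y₀ 1 with hy₁
  have hy₁0 : 0 < y₁ := lt_of_lt_of_le one_pos (le_max_right _ _)
  have hy₁y : ∀ y, y₁ ≤ y → y₀ ≤ y := fun y hy ↦ (le_max_left _ _).trans hy
  refine martingale_driver_of_coefficients hWad hWc hmom (a := 1) (b := 1) (κ := 3) (K := 300)
    one_ne_zero one_ne_zero hy₁0
    (Ore := fun y r ω ↦ (stoppedSpinObservable W y r ω).re)
    (Oim := fun y r ω ↦ (stoppedSpinObservable W y r ω).im)
    (fun y hy ↦ hre y (hy₁y y hy)) (fun y hy ↦ him y (hy₁y y hy)) ?_ ?_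
  · intro y hy t M hM0
    have hy0 : 0 < y := hy₁0.trans_le hy
    exact ae_of_all _ fun ω hω r hr ↦ abs_im_stoppedSpinObservable_add_le hWc hW0 hy0 (hM0 ω) hω hr
  · intro y hy t M hM0
    have hy0 : 0 < y := hy₁0.trans_le hy
    exact ae_of_all _ fun ω hω r hr ↦ abs_re_stoppedSpinObservable_sub_le hWc hW0 hy0 (hM0 ω) hω hr

end Spin

end Loewner

end Literature.Probability.RandomPlanarGeometry
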